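/-
Copyright (c) 2026. All rights reserved.
Released under Apache 2.0 license as described in the file LICENSE.
Authors: abc-iut cell, seat abc-iut-w5-d019 (gen 8).
-/
import Mathlib.GroupTheory.Nilpotent
import Mathlib.GroupTheory.QuotientGroup.Defs
import Mathlib.Algebra.Group.Pointwise.Set.ListOfFn

/-!
# Commutator width of `[G, N]` for a nilpotent normal subgroup `N` (relative form of the
# Dixon–du Sautoy–Mann–Segal collection lemma; the nilpotent layer of B. Hartley's width theorem)

Let `G` be a group generated by the entries `a₁, …, a_d` of a list `l`, and let `N ⊴ G` be a NILPOTENT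
normal subgroup (its lower central series `γ₀ = N`, `γ_{j+1} = ⁅γ_j, N⁆`, computed in `G`
— Mathlib `N.lowerCentralSeries` — reaches `⊥`) which is the normal closure of the entries
`b₁, …, b_e ∈ N` of a second list `v`.  Then EVERY element of `⁅G, N⁆` is a product
`⁅x₁, a₁⁆ ⋯ ⁅x_d, a_d⁆ · ⁅y₁, b₁⁆ ⋯ ⁅y_e, b_e⁆` with all `xᵢ, yⱼ ∈ N` — commutator width `≤ d + e`
(`commutator_top_eq_listProd_of_lowerCentralSeries_eq_bot`, `…_of_isNilpotent`).  For `N = G`, `v = []`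
this is the classical nilpotent collection lemma (tree: `CommutatorWidthLowerCentral.lean`,
seat abc-iut-w5-d218; DdSMS Prop. 1.19).  The relative form is the nilpotent layer of B. Hartley's
theorem "an `m`-generated finite group of Fitting height `c` has commutator width
`≤ m + (2m − 1)(c − 1)`" (Math. Z. 168 (1979), Thm 2 — text not held by the tree; the proof here is
independent and gives the weaker but uniform bound `d + e`).

Proof.  Write `T(w) = {⁅y₁,c₁⁆ ⋯ ⁅y_k,c_k⁆ | yᵢ ∈ Eᵢ}` for a list `w` of pairs `(cᵢ, Eᵢ)` (element,
subgroup of entries); no definition is introduced, the pointwise list product is spelled out.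
(A) For `K ⊴ G` and `D ⊴ G` with `⁅K, K⁆ ≤ D`: `⁅G, K⁆ ⊆ T((aᵢ, K)ᵢ) · D` — modulo `D` the map
`x ↦ ⁅x, g⁆` is additive on the abelian `K/D`, and `{g | ⁅K, g⁆ ⊆ T·D}` is a subgroup containing the
generators (`⁅x, gh⁆ ≡ ⁅hxh⁻¹, g⁆⁅x, h⁆`, `⁅x, g⁻¹⁆ ≡ ⁅(g⁻¹xg)⁻¹, g⁆`).
(B) `γ_{j+1} ⊆ T((aᵢ, γ_{j+1})ᵢ ++ (b, γ_j)_b) · γ_{j+2}`: `γ_{j+1} = ⁅γ_j, N⁆` is generated by the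
`⁅y, x⁆`, `x ↦ ⁅y, x⁆` is additive modulo `γ_{j+2}`, `x` runs over products of conjugates `g b g⁻¹`, and
`⁅y, gbg⁻¹⁆ = g⁅g⁻¹yg, b⁆g⁻¹ = ⁅g, c⁆·c` with `⁅g, c⁆ ∈ ⁅G, γ_{j+1}⁆` handled by (A).
(C) Merge: a product in `T((a,N)ᵢ ++ (b,N)_b)` times a product of "deep" commutators (lying in
`γ_{j+1}`) is again in `T(…)` modulo `γ_{j+2}` (`⁅x,c⁆⁅z,c⁆ ≡ ⁅xz,c⁆` when `⁅z,c⁆ ∈ γ_{j+1}`), and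
induct on `j`.

Consumers (cell abc-iut, GAP-LEDGER G-L3d2g2-1): uniform commutator width in the finite quotients
`Gal(E/k)` of the absolute Galois group of a `p`-adic field (`N` = wild inertia `G₁`, nilpotent;
`Gal/G₁` metacyclic), whence closedness of the derived subgroup and strong completeness.
Classical group theory over Mathlib; no definition, no instance; nothing here bears on
[IUTchIII] Cor. 3.12 or asserts anything about abc.

[cite: DDMSAnalyticProP1999, Prop 1.19 (proof)]
-/

namespace Literature.GroupTheory

namespace NilpotentNormalWidth

open scoped Pointwise commutatorElement

variable {G : Type*} [Group G]

/-! ### The sets `T(w) = {⁅y₁,c₁⁆ ⋯ ⁅y_k,c_k⁆ | yᵢ ∈ Eᵢ}` for a list `w` of pairs `(cᵢ, Eᵢ)` -/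

/-- `1 ∈ T(w)` (all `yᵢ = 1`). [cite: DDMSAnalyticProP1999, Prop 1.19 (proof)] -/
theorem one_mem_listProd (w : List (G × Subgroup G)) :
    (1 : G) ∈ (w.map fun p : G × Subgroup G => (fun y : G => ⁅y, p.1⁆) '' (p.2 : Set G)).prod := by
  induction w with
  | nil => simp
  | cons p w ih =>
    rw [List.map_cons, List.prod_cons]
    exact Set.mem_mul.mpr ⟨1, ⟨1, p.2.one_mem, commutatorElement_one_left p.1⟩, 1, ih, one_mul 1⟩

/-- For an entry `(c, E)` of `w` and `y ∈ E`, `⁅y, c⁆ ∈ T(w)`.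
[cite: DDMSAnalyticProP1999, Prop 1.19 (proof)] -/
theorem comm_mem_listProd {w : List (G × Subgroup G)} {p : G × Subgroup G} (hp : p ∈ w) {y : G}
    (hy : y ∈ p.2) :
    ⁅y, p.1⁆ ∈ (w.map fun p : G × Subgroup G => (fun y : G => ⁅y, p.1⁆) '' (p.2 : Set G)).prod := by
  induction w with
  | nil => simp at hp
  | cons q w ih =>
    rw [List.map_cons, List.prod_cons]
    rcases List.mem_cons.mp hp with rfl | hp'
    · exact Set.mem_mul.mpr ⟨⁅y, p.1⁆, ⟨y, hy, rfl⟩, 1, one_mem_listProd w, mul_one _⟩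
    · exact Set.mem_mul.mpr ⟨1, ⟨1, q.2.one_mem, commutatorElement_one_left q.1⟩, ⁅y, p.1⁆, ih hp',
        one_mul _⟩

/-- `T(w₁ ++ w₂) = T(w₁) · T(w₂)`. [cite: DDMSAnalyticProP1999, Prop 1.19 (proof)] -/
theorem listProd_append (w₁ w₂ : List (G × Subgroup G)) :
    ((w₁ ++ w₂).map fun p : G × Subgroup G => (fun y : G => ⁅y, p.1⁆) '' (p.2 : Set G)).prod =
      (w₁.map fun p : G × Subgroup G => (fun y : G => ⁅y, p.1⁆) '' (p.2 : Set G)).prod *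
        (w₂.map fun p : G × Subgroup G => (fun y : G => ⁅y, p.1⁆) '' (p.2 : Set G)).prod := by
  rw [List.map_append, List.prod_append]

/-- If every commutator `⁅y, c⁆` (`(c, E) ∈ w`, `y ∈ E`) lies in the subgroup `K`, then
`T(w) ⊆ K`. [cite: DDMSAnalyticProP1999, Prop 1.19 (proof)] -/
theorem listProd_subset {w : List (G × Subgroup G)} {K : Subgroup G}
    (hw : ∀ p ∈ w, ∀ y ∈ p.2, ⁅y, p.1⁆ ∈ K) :
    (w.map fun p : G × Subgroup G => (fun y : G => ⁅y, p.1⁆) '' (p.2 : Set G)).prod ⊆ (K : Set G) := by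
  induction w with
  | nil =>
    rw [List.map_nil, List.prod_nil]
    intro x hx
    rw [Set.mem_one] at hx
    rw [hx]
    exact K.one_mem
  | cons q w ih =>
    rw [List.map_cons, List.prod_cons]
    intro x hx
    obtain ⟨c, ⟨y, hy, rfl⟩, u, hu, rfl⟩ := Set.mem_mul.mp hx
    exact K.mul_mem (hw q (by simp) y hy) (ih (fun p hp => hw p (by simp [hp])) hu)

/-- Monotonicity / transfer to "deep" products: if `w₁`, `w₂` have the same first components, the
entry subgroups of `w₁` are contained in those of `w₂`, and all commutators from `w₁` lie in `C`, then
`T(w₁)` is contained in the set of `w₂`-products of commutators lying in `C`.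
[cite: DDMSAnalyticProP1999, Prop 1.19 (proof)] -/
theorem listProd_subset_deep {C : Subgroup G} {w₁ w₂ : List (G × Subgroup G)}
    (h : List.Forall₂ (fun p q : G × Subgroup G => p.1 = q.1 ∧ p.2 ≤ q.2 ∧ ∀ y ∈ p.2, ⁅y, p.1⁆ ∈ C)
      w₁ w₂) :
    (w₁.map fun p : G × Subgroup G => (fun y : G => ⁅y, p.1⁆) '' (p.2 : Set G)).prod ⊆
      (w₂.map fun p : G × Subgroup G =>
        {c : G | c ∈ C ∧ ∃ y ∈ (p.2 : Set G), ⁅y, p.1⁆ = c}).prod := by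
  induction h with
  | nil => simp
  | @cons p q w₁ w₂ hpq _ ih =>
    rw [List.map_cons, List.prod_cons, List.map_cons, List.prod_cons]
    intro x hx
    obtain ⟨c, ⟨y, hy, rfl⟩, u, hu, rfl⟩ := Set.mem_mul.mp hx
    obtain ⟨h1, h2, h3⟩ := hpq
    exact Set.mem_mul.mpr ⟨⁅y, p.1⁆, ⟨h3 y hy, y, h2 hy, by rw [← h1]⟩, u, ih hu, rfl⟩

/-- "Deep" products are products: the set of `w`-products of commutators lying in `C` is contained
in `T(w)`. [cite: DDMSAnalyticProP1999, Prop 1.19 (proof)] -/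
theorem deep_subset_listProd (C : Subgroup G) (w : List (G × Subgroup G)) :
    (w.map fun p : G × Subgroup G => {c : G | c ∈ C ∧ ∃ y ∈ (p.2 : Set G), ⁅y, p.1⁆ = c}).prod ⊆
      (w.map fun p : G × Subgroup G => (fun y : G => ⁅y, p.1⁆) '' (p.2 : Set G)).prod := by
  induction w with
  | nil => simp
  | cons q w ih =>
    rw [List.map_cons, List.prod_cons, List.map_cons, List.prod_cons]
    intro x hx
    obtain ⟨c, ⟨_, y, hy, rfl⟩, u, hu, rfl⟩ := Set.mem_mul.mp hx
    exact Set.mem_mul.mpr ⟨⁅y, q.1⁆, ⟨y, hy, rfl⟩, u, ih hu, rfl⟩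

/-- "Deep" products lie in `C`. [cite: DDMSAnalyticProP1999, Prop 1.19 (proof)] -/
theorem deep_subset (C : Subgroup G) (w : List (G × Subgroup G)) :
    (w.map fun p : G × Subgroup G => {c : G | c ∈ C ∧ ∃ y ∈ (p.2 : Set G), ⁅y, p.1⁆ = c}).prod ⊆
      (C : Set G) := by
  induction w with
  | nil =>
    rw [List.map_nil, List.prod_nil]
    intro x hx
    rw [Set.mem_one] at hx
    rw [hx]
    exact C.one_mem
  | cons q w ih =>
    rw [List.map_cons, List.prod_cons]
    intro x hx
    obtain ⟨c, ⟨hc, _⟩, u, hu, rfl⟩ := Set.mem_mul.mp hx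
    exact C.mul_mem hc (ih hu)

/-! ### Congruences modulo a normal subgroup `D` -/

/-- If `⁅c, x⁆ ∈ D` then the images of `c` and `x` in `G ⧸ D` commute.
[cite: DDMSAnalyticProP1999, Prop 1.19 (proof)] -/
theorem commute_mk_of_commutator_mem {D : Subgroup G} [D.Normal] {c x : G} (h : ⁅c, x⁆ ∈ D) :
    Commute (QuotientGroup.mk' D c) (QuotientGroup.mk' D x) := by
  have h1 : QuotientGroup.mk' D ⁅c, x⁆ = 1 := by
    rw [QuotientGroup.mk'_apply, QuotientGroup.eq_one_iff]
    exact h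
  rwa [map_commutatorElement, commutatorElement_eq_one_iff_commute] at h1

/-- The merging congruence: if `y` commutes modulo `D` with the "deep" commutator `⁅z, c⁆`, then
`⁅y * z, c⁆ ≡ ⁅z, c⁆ * ⁅y, c⁆ (mod D)`. [cite: DDMSAnalyticProP1999, Prop 1.19 (proof)] -/
theorem mk_comm_mul_left_eq {D : Subgroup G} [D.Normal] {y z c : G} (h : ⁅⁅z, c⁆, y⁆ ∈ D) :
    QuotientGroup.mk' D ⁅y * z, c⁆ = QuotientGroup.mk' D ⁅z, c⁆ * QuotientGroup.mk' D ⁅y, c⁆ := by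
  have hc := commute_mk_of_commutator_mem h
  rw [map_commutatorElement] at hc
  simp only [map_commutatorElement, map_mul]
  rw [commutatorElement_mul_left_eq_conj_mul, ← hc.eq, mul_inv_cancel_right]

/-- Three pairwise commuting elements: `X X₂⁻¹ = X₁ X₂⁻¹ X X₁⁻¹` (abelian bookkeeping for layer (A)).
[cite: DDMSAnalyticProP1999, Prop 1.19 (proof)] -/
theorem mul_inv_eq_of_commute {Q : Type*} [Group Q] (X X₁ X₂ : Q) (c1 : Commute X X₁)
    (c2 : Commute X X₂) (c3 : Commute X₁ X₂) : X * X₂⁻¹ = X₁ * X₂⁻¹ * X * X₁⁻¹ := by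
  symm
  calc X₁ * X₂⁻¹ * X * X₁⁻¹ = X₁ * (X₂⁻¹ * X) * X₁⁻¹ := by simp only [mul_assoc]
    _ = X₁ * (X * X₂⁻¹) * X₁⁻¹ := by rw [← c2.inv_right.eq]
    _ = (X₁ * X) * (X₂⁻¹ * X₁⁻¹) := by simp only [mul_assoc]
    _ = (X * X₁) * (X₁⁻¹ * X₂⁻¹) := by rw [← c1.eq, ← c3.inv_inv.eq]
    _ = X * X₂⁻¹ := by simp [mul_assoc]

/-! ### The merge lemma -/

/-- **Merge lemma.** Let `D ⊴ G`, let `M` be a subgroup and `C` a subgroup whose elements commute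
with `M` modulo `D`.  Let `w` be a list of pairs `(c, E)` with `E ≤ M` and `⁅E, c⁆ ⊆ M`.  Then a
product `u ∈ T(w)` times a `w`-product `t` of commutators lying in `C` is congruent modulo `D` to an
element of `T(w)` (merge factor by factor: `⁅x,c⁆⁅z,c⁆ ≡ ⁅xz,c⁆`).
[cite: DDMSAnalyticProP1999, Prop 1.19 (proof)] -/
theorem exists_listProd_mk_eq_mul_deep {D : Subgroup G} [D.Normal] (M C : Subgroup G)
    (hC : ∀ x ∈ M, ∀ c ∈ C, ⁅c, x⁆ ∈ D) :
    ∀ (w : List (G × Subgroup G)), (∀ p ∈ w, p.2 ≤ M ∧ ∀ y ∈ p.2, ⁅y, p.1⁆ ∈ M) →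
      ∀ (u t : G), u ∈ (w.map fun p : G × Subgroup G =>
          (fun y : G => ⁅y, p.1⁆) '' (p.2 : Set G)).prod →
        t ∈ (w.map fun p : G × Subgroup G =>
          {c : G | c ∈ C ∧ ∃ y ∈ (p.2 : Set G), ⁅y, p.1⁆ = c}).prod →
        ∃ m ∈ (w.map fun p : G × Subgroup G => (fun y : G => ⁅y, p.1⁆) '' (p.2 : Set G)).prod,
          QuotientGroup.mk' D m = QuotientGroup.mk' D (u * t)
  | [], _, u, t, hu, ht => by
    simp only [List.map_nil, List.prod_nil, Set.mem_one] at hu ht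
    subst hu; subst ht
    exact ⟨1, one_mem_listProd [], by rw [mul_one]⟩
  | p :: w, hw, u, t, hu, ht => by
    rw [List.map_cons, List.prod_cons] at hu ht ⊢
    obtain ⟨c, ⟨y, hy, rfl⟩, u₀, hu₀, rfl⟩ := Set.mem_mul.mp hu
    obtain ⟨d, ⟨hdC, z, hz, rfl⟩, t₀, ht₀, rfl⟩ := Set.mem_mul.mp ht
    have hw₀ : ∀ q ∈ w, q.2 ≤ M ∧ ∀ y ∈ q.2, ⁅y, q.1⁆ ∈ M := fun q hq => hw q (by simp [hq])
    obtain ⟨m₀, hm₀, hm₀eq⟩ := exists_listProd_mk_eq_mul_deep M C hC w hw₀ u₀ t₀ hu₀ ht₀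
    obtain ⟨hpM, hpcomm⟩ := hw p (by simp)
    -- `u₀ ∈ M`, so it commutes with the deep commutator `⁅z, p.1⁆ ∈ C` modulo `D`
    have hu₀M : u₀ ∈ M := listProd_subset (K := M) (fun q hq => (hw₀ q hq).2) hu₀
    refine ⟨⁅y * z, p.1⁆ * m₀, Set.mem_mul.mpr ⟨⁅y * z, p.1⁆, ⟨y * z, p.2.mul_mem hy hz, rfl⟩, m₀, hm₀,
      rfl⟩, ?_⟩
    have hyz : QuotientGroup.mk' D ⁅y * z, p.1⁆ =
        QuotientGroup.mk' D ⁅z, p.1⁆ * QuotientGroup.mk' D ⁅y, p.1⁆ :=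
      mk_comm_mul_left_eq (hC y (hpM hy) _ hdC)
    have h1 : Commute (QuotientGroup.mk' D ⁅z, p.1⁆) (QuotientGroup.mk' D ⁅y, p.1⁆) :=
      commute_mk_of_commutator_mem (hC _ (hpcomm y hy) _ hdC)
    have h2 : Commute (QuotientGroup.mk' D ⁅z, p.1⁆) (QuotientGroup.mk' D u₀) :=
      commute_mk_of_commutator_mem (hC u₀ hu₀M _ hdC)
    simp only [map_mul]
    rw [hyz, hm₀eq, map_mul]
    calc QuotientGroup.mk' D ⁅z, p.1⁆ * QuotientGroup.mk' D ⁅y, p.1⁆ *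
          (QuotientGroup.mk' D u₀ * QuotientGroup.mk' D t₀)
        = QuotientGroup.mk' D ⁅y, p.1⁆ * QuotientGroup.mk' D ⁅z, p.1⁆ *
          (QuotientGroup.mk' D u₀ * QuotientGroup.mk' D t₀) := by rw [h1.eq]
      _ = QuotientGroup.mk' D ⁅y, p.1⁆ * (QuotientGroup.mk' D ⁅z, p.1⁆ * QuotientGroup.mk' D u₀) *
          QuotientGroup.mk' D t₀ := by simp only [mul_assoc]
      _ = QuotientGroup.mk' D ⁅y, p.1⁆ * (QuotientGroup.mk' D u₀ * QuotientGroup.mk' D ⁅z, p.1⁆) *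
          QuotientGroup.mk' D t₀ := by rw [h2.eq]
      _ = QuotientGroup.mk' D ⁅y, p.1⁆ * QuotientGroup.mk' D u₀ *
          (QuotientGroup.mk' D ⁅z, p.1⁆ * QuotientGroup.mk' D t₀) := by simp only [mul_assoc]

/-- **Inverse lemma (commutative case).** With `D`, `M`, `C` as in the merge lemma, `C ≤ M`, and all
commutators `⁅E, c⁆` (`(c, E) ∈ w`) lying in `C`, the inverse of an element of `T(w)` is congruent
modulo `D` to an element of `T(w)` (`⁅y,c⁆⁻¹ ≡ ⁅y⁻¹,c⁆`).
[cite: DDMSAnalyticProP1999, Prop 1.19 (proof)] -/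
theorem exists_listProd_mk_eq_inv {D : Subgroup G} [D.Normal] (M C : Subgroup G) (hCM : C ≤ M)
    (hC : ∀ x ∈ M, ∀ c ∈ C, ⁅c, x⁆ ∈ D) :
    ∀ (w : List (G × Subgroup G)), (∀ p ∈ w, p.2 ≤ M ∧ ∀ y ∈ p.2, ⁅y, p.1⁆ ∈ C) →
      ∀ (u : G), u ∈ (w.map fun p : G × Subgroup G =>
          (fun y : G => ⁅y, p.1⁆) '' (p.2 : Set G)).prod →
        ∃ m ∈ (w.map fun p : G × Subgroup G => (fun y : G => ⁅y, p.1⁆) '' (p.2 : Set G)).prod,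
          QuotientGroup.mk' D m = (QuotientGroup.mk' D u)⁻¹
  | [], _, u, hu => by
    simp only [List.map_nil, List.prod_nil, Set.mem_one] at hu
    subst hu
    exact ⟨1, one_mem_listProd [], by rw [map_one, inv_one]⟩
  | p :: w, hw, u, hu => by
    rw [List.map_cons, List.prod_cons] at hu ⊢
    obtain ⟨c, ⟨y, hy, rfl⟩, u₀, hu₀, rfl⟩ := Set.mem_mul.mp hu
    have hw₀ : ∀ q ∈ w, q.2 ≤ M ∧ ∀ y ∈ q.2, ⁅y, q.1⁆ ∈ C := fun q hq => hw q (by simp [hq])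
    obtain ⟨m₀, hm₀, hm₀eq⟩ := exists_listProd_mk_eq_inv M C hCM hC w hw₀ u₀ hu₀
    obtain ⟨hpM, hpC⟩ := hw p (by simp)
    have hu₀C : u₀ ∈ C := listProd_subset (K := C) (fun q hq => (hw₀ q hq).2) hu₀
    refine ⟨⁅y⁻¹, p.1⁆ * m₀, Set.mem_mul.mpr ⟨⁅y⁻¹, p.1⁆, ⟨y⁻¹, p.2.inv_mem hy, rfl⟩, m₀, hm₀, rfl⟩,
      ?_⟩
    -- `⁅y, c⁆ ⁅y⁻¹, c⁆ ≡ ⁅y⁻¹ y, c⁆ = 1`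
    have hinv : QuotientGroup.mk' D ⁅y⁻¹, p.1⁆ = (QuotientGroup.mk' D ⁅y, p.1⁆)⁻¹ := by
      have h := mk_comm_mul_left_eq (D := D) (y := y⁻¹) (z := y) (c := p.1)
        (hC _ (hpM (p.2.inv_mem hy)) _ (hpC y hy))
      rw [inv_mul_cancel, commutatorElement_one_left, map_one] at h
      exact eq_inv_of_mul_eq_one_right h.symm
    have hcomm : Commute (QuotientGroup.mk' D ⁅y, p.1⁆) (QuotientGroup.mk' D u₀) :=
      commute_mk_of_commutator_mem (hC _ (hCM hu₀C) _ (hpC y hy))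
    simp only [map_mul]
    rw [hinv, hm₀eq, mul_inv_rev]
    exact hcomm.inv_inv.eq

/-- **`T(w) · D` is a subgroup (commutative case).**  With `D ⊴ G`, subgroups `C ≤ M` such that `C`
commutes with `M` modulo `D`, and a list `w` of pairs `(c, E)` with `E ≤ M` and `⁅E, c⁆ ⊆ C`, there is a
subgroup of `G` whose underlying set is `T(w) · D`. [cite: DDMSAnalyticProP1999, Prop 1.19 (proof)] -/
theorem exists_subgroup_coe_eq_listProd_mul {D : Subgroup G} [D.Normal] (M C : Subgroup G)
    (hCM : C ≤ M) (hC : ∀ x ∈ M, ∀ c ∈ C, ⁅c, x⁆ ∈ D) {w : List (G × Subgroup G)}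
    (hw : ∀ p ∈ w, p.2 ≤ M ∧ ∀ y ∈ p.2, ⁅y, p.1⁆ ∈ C) :
    ∃ Y : Subgroup G, (Y : Set G) =
      (w.map fun p : G × Subgroup G => (fun y : G => ⁅y, p.1⁆) '' (p.2 : Set G)).prod * (D : Set G) := by
  have hwM : ∀ p ∈ w, p.2 ≤ M ∧ ∀ y ∈ p.2, ⁅y, p.1⁆ ∈ M :=
    fun p hp => ⟨(hw p hp).1, fun y hy => hCM ((hw p hp).2 y hy)⟩
  generalize hS : (w.map fun p : G × Subgroup G =>
      (fun y : G => ⁅y, p.1⁆) '' (p.2 : Set G)).prod * (D : Set G) = S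
  refine ⟨Subgroup.mk (Submonoid.mk (Subsemigroup.mk S ?_) ?_) ?_, rfl⟩
  · intro a b ha hb
    change a ∈ S at ha; change b ∈ S at hb
    rw [← hS] at ha hb ⊢
    obtain ⟨u, hu, d, hd, rfl⟩ := Set.mem_mul.mp ha
    obtain ⟨u', hu', d', hd', rfl⟩ := Set.mem_mul.mp hb
    -- `u'` is a product of commutators lying in `C`: a "deep" product
    have hforall : List.Forall₂
        (fun p q : G × Subgroup G => p.1 = q.1 ∧ p.2 ≤ q.2 ∧ ∀ y ∈ p.2, ⁅y, p.1⁆ ∈ C) w w :=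
      List.forall₂_same.mpr fun p hp => ⟨rfl, le_rfl, (hw p hp).2⟩
    have hsub := listProd_subset_deep hforall
    have hu'deep : u' ∈ (w.map fun p : G × Subgroup G =>
        {c : G | c ∈ C ∧ ∃ y ∈ (p.2 : Set G), ⁅y, p.1⁆ = c}).prod := hsub hu'
    obtain ⟨m, hm, hmeq⟩ := exists_listProd_mk_eq_mul_deep M C hC w hwM u u' hu hu'deep
    refine Set.mem_mul.mpr ⟨m, hm, m⁻¹ * (u * d * (u' * d')), ?_, by rw [mul_inv_cancel_left]⟩
    have h1 : m⁻¹ * (u * u') ∈ D := by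
      rw [QuotientGroup.mk'_apply, QuotientGroup.mk'_apply] at hmeq
      exact QuotientGroup.eq.mp hmeq
    have h2 : u'⁻¹ * d * u' ∈ D := Subgroup.Normal.conj_mem' inferInstance d hd u'
    have : m⁻¹ * (u * d * (u' * d')) = (m⁻¹ * (u * u')) * (u'⁻¹ * d * u') * d' := by group
    rw [this]
    exact D.mul_mem (D.mul_mem h1 h2) hd'
  · change (1 : G) ∈ S
    rw [← hS]
    exact Set.mem_mul.mpr ⟨1, one_mem_listProd w, 1, D.one_mem, mul_one 1⟩
  · intro a ha
    change a ∈ S at ha; change a⁻¹ ∈ S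
    rw [← hS] at ha ⊢
    obtain ⟨u, hu, d, hd, rfl⟩ := Set.mem_mul.mp ha
    obtain ⟨m, hm, hmeq⟩ := exists_listProd_mk_eq_inv M C hCM hC w hw u hu
    refine Set.mem_mul.mpr ⟨m, hm, m⁻¹ * (u * d)⁻¹, ?_, by rw [mul_inv_cancel_left]⟩
    have h1 : m⁻¹ * u⁻¹ ∈ D := by
      rw [← map_inv, QuotientGroup.mk'_apply, QuotientGroup.mk'_apply] at hmeq
      exact QuotientGroup.eq.mp hmeq
    have h2 : u * d⁻¹ * u⁻¹ ∈ D := Subgroup.Normal.conj_mem inferInstance _ (D.inv_mem hd) u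
    have : m⁻¹ * (u * d)⁻¹ = (m⁻¹ * u⁻¹) * (u * d⁻¹ * u⁻¹) := by group
    rw [this]
    exact D.mul_mem h1 h2

/-! ### (A) `⁅G, K⁆ ⊆ T((aᵢ, K)ᵢ) · D` for `K ⊴ G` abelian modulo `D` -/

/-- For `K ⊴ G`, `y ∈ K` and any `a`, the commutator `⁅y, a⁆` lies in `K`.
[cite: DDMSAnalyticProP1999, Prop 1.19 (proof)] -/
theorem commutatorElement_mem_left {K : Subgroup G} [K.Normal] {y : G} (hy : y ∈ K) (a : G) :
    ⁅y, a⁆ ∈ K :=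
  Subgroup.commutator_le_left K ⊤ (Subgroup.commutator_mem_commutator hy (Subgroup.mem_top a))

/-- For `K ⊴ G`, `y ∈ K` and any `a`, the commutator `⁅a, y⁆` lies in `K`.
[cite: DDMSAnalyticProP1999, Prop 1.19 (proof)] -/
theorem commutatorElement_mem_right {K : Subgroup G} [K.Normal] (a : G) {y : G} (hy : y ∈ K) :
    ⁅a, y⁆ ∈ K :=
  Subgroup.commutator_le_right ⊤ K (Subgroup.commutator_mem_commutator (Subgroup.mem_top a) hy)

/-- **Layer lemma (A).** Let `K ⊴ G` and `D ⊴ G` with `⁅K, K⁆ ≤ D`, and let the entries of `l`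
generate `G`.  Then every element of `⁅G, K⁆` is congruent modulo `D` to a product
`⁅x₁, a₁⁆ ⋯ ⁅x_d, a_d⁆` with `xᵢ ∈ K` ("`(G − 1)·(K/D) = Σᵢ (aᵢ − 1)·(K/D)`").
[cite: DDMSAnalyticProP1999, Prop 1.19 (proof)] -/
theorem commutator_top_subset_listProd_mul (K D : Subgroup G) [K.Normal] [D.Normal]
    (hKD : ⁅K, K⁆ ≤ D) {l : List G} (hl : Subgroup.closure {a : G | a ∈ l} = ⊤) :
    ((⁅(⊤ : Subgroup G), K⁆ : Subgroup G) : Set G) ⊆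
      ((l.map fun a => (a, K)).map fun p : G × Subgroup G =>
        (fun y : G => ⁅y, p.1⁆) '' (p.2 : Set G)).prod * (D : Set G) := by
  have hC : ∀ x ∈ K, ∀ c ∈ K, ⁅c, x⁆ ∈ D :=
    fun x hx c hc => hKD (Subgroup.commutator_mem_commutator hc hx)
  have hw : ∀ p ∈ (l.map fun a => (a, K)), p.2 ≤ K ∧ ∀ y ∈ p.2, ⁅y, p.1⁆ ∈ K := by
    intro p hp
    obtain ⟨a, _, rfl⟩ := List.mem_map.mp hp
    exact ⟨le_rfl, fun y hy => commutatorElement_mem_left hy a⟩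
  obtain ⟨Y, hY⟩ := exists_subgroup_coe_eq_listProd_mul (D := D) K K le_rfl hC hw
  -- membership in `Y`
  have hYD : D ≤ Y := fun d hd => by
    rw [← SetLike.mem_coe, hY]
    exact Set.mem_mul.mpr ⟨1, one_mem_listProd _, d, hd, one_mul d⟩
  have hYmk : ∀ {g g' : G}, QuotientGroup.mk' D g = QuotientGroup.mk' D g' → g' ∈ Y → g ∈ Y := by
    intro g g' hgg' hg'
    rw [QuotientGroup.mk'_apply, QuotientGroup.mk'_apply] at hgg'
    have h : g⁻¹ * g' ∈ D := QuotientGroup.eq.mp hgg'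
    have : g = g' * (g⁻¹ * g')⁻¹ := by group
    rw [this]
    exact Y.mul_mem hg' (Y.inv_mem (hYD h))
  have hcommY : ∀ a ∈ l, ∀ x ∈ K, ⁅x, a⁆ ∈ Y := by
    intro a ha x hx
    rw [← SetLike.mem_coe, hY]
    refine Set.mem_mul.mpr ⟨⁅x, a⁆, ?_, 1, D.one_mem, mul_one _⟩
    exact comm_mem_listProd (w := l.map fun a => (a, K)) (p := (a, K))
      (List.mem_map.mpr ⟨a, ha, rfl⟩) hx
  -- in `G ⧸ D` the elements of `K` pairwise commute
  have hKcomm : ∀ x ∈ K, ∀ x' ∈ K, Commute (QuotientGroup.mk' D x) (QuotientGroup.mk' D x') :=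
    fun x hx x' hx' => commute_mk_of_commutator_mem (hC x' hx' x hx)
  have hconjK : ∀ (g : G) {x : G}, x ∈ K → g * x * g⁻¹ ∈ K :=
    fun g x hx => Subgroup.Normal.conj_mem inferInstance x hx g
  -- the subgroup `{g | ∀ x ∈ K, ⁅x, g⁆ ∈ Y}` contains the generators, hence is everything
  have key : ∀ g : G, ∀ x ∈ K, ⁅x, g⁆ ∈ Y := by
    intro g
    have hg : g ∈ Subgroup.closure {a : G | a ∈ l} := by rw [hl]; exact Subgroup.mem_top g
    refine Subgroup.closure_induction (p := fun g _ => ∀ x ∈ K, ⁅x, g⁆ ∈ Y) ?_ ?_ ?_ ?_ hg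
    · exact fun a ha x hx => hcommY a ha x hx
    · intro x _
      rw [commutatorElement_one_right]
      exact Y.one_mem
    · intro g h _ _ ihg ihh x hx
      -- `⁅x, g h⁆ ≡ ⁅h x h⁻¹, g⁆ ⁅x, h⁆`
      obtain ⟨x₁, hx₁e⟩ : ∃ x₁, h * x * h⁻¹ = x₁ := ⟨_, rfl⟩
      obtain ⟨x₂, hx₂e⟩ : ∃ x₂, (g * h) * x * (g * h)⁻¹ = x₂ := ⟨_, rfl⟩
      have hx₁ : x₁ ∈ K := hx₁e ▸ hconjK h hx
      have hx₂ : x₂ ∈ K := hx₂e ▸ hconjK (g * h) hx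
      refine hYmk ?_ (Y.mul_mem (ihg x₁ hx₁) (ihh x hx))
      have e1 : ⁅x, g * h⁆ = x * x₂⁻¹ := by
        rw [← hx₂e]; simp only [commutatorElement_def]; group
      have e2 : ⁅x₁, g⁆ * ⁅x, h⁆ = x₁ * x₂⁻¹ * x * x₁⁻¹ := by
        rw [← hx₁e, ← hx₂e]; simp only [commutatorElement_def]; group
      rw [e1, e2]
      simp only [map_mul, map_inv]
      exact mul_inv_eq_of_commute _ _ _ (hKcomm x hx x₁ hx₁) (hKcomm x hx x₂ hx₂)
        (hKcomm x₁ hx₁ x₂ hx₂)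
    · intro g _ ihg x hx
      -- `⁅x, g⁻¹⁆ ≡ ⁅(g⁻¹ x g)⁻¹, g⁆`
      obtain ⟨x₃, hx₃e⟩ : ∃ x₃, g⁻¹ * x * g⁻¹⁻¹ = x₃ := ⟨_, rfl⟩
      have hx₃ : x₃ ∈ K := hx₃e ▸ hconjK g⁻¹ hx
      refine hYmk ?_ (ihg x₃⁻¹ (K.inv_mem hx₃))
      have e1 : ⁅x, g⁻¹⁆ = x * x₃⁻¹ := by
        rw [← hx₃e]; simp only [commutatorElement_def]; group
      have e2 : ⁅x₃⁻¹, g⁆ = x₃⁻¹ * x := by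
        rw [← hx₃e]; simp only [commutatorElement_def]; group
      rw [e1, e2]
      simp only [map_mul, map_inv]
      exact (hKcomm x hx x₃ hx₃).inv_right.eq
  -- conclusion
  intro g hg
  rw [← hY, SetLike.mem_coe]
  have hle : ⁅(⊤ : Subgroup G), K⁆ ≤ Y := by
    rw [Subgroup.commutator_le]
    intro g _ x hx
    rw [← commutatorElement_inv]
    exact Y.inv_mem (key g x hx)
  exact hle hg


/-! ### (B) The layers of the lower central series of `N` -/

/-- `Forall₂` for two maps of the same list (list bookkeeping for the layer transfer).
[cite: DDMSAnalyticProP1999, Prop 1.19 (proof)] -/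
theorem forall₂_map_map_of_forall {α β γ : Type*} {R : β → γ → Prop} {f : α → β} {g : α → γ}
    {l : List α} (h : ∀ a ∈ l, R (f a) (g a)) : List.Forall₂ R (l.map f) (l.map g) := by
  rw [List.forall₂_map_left_iff, List.forall₂_map_right_iff, List.forall₂_same]
  exact h

/-- **Layer lemma (B).** Let `N ⊴ G` be the normal closure of the entries of `v` (all in `N`), and
let the entries of `l` generate `G`; write `γ_j = N.lowerCentralSeries j`.  Then every element of
`γ_{j+1} = ⁅γ_j, N⁆` is congruent modulo `γ_{j+2}` to a product `∏ᵢ ⁅zᵢ, aᵢ⁆ · ∏_b ⁅y_b, b⁆` with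
`zᵢ ∈ γ_{j+1}` and `y_b ∈ γ_j`. [cite: DDMSAnalyticProP1999, Prop 1.19 (proof)] -/
theorem lowerCentralSeries_succ_subset_listProd_mul (N : Subgroup G) [N.Normal] {l : List G}
    (hl : Subgroup.closure {a : G | a ∈ l} = ⊤) {v : List G} (hv : ∀ b ∈ v, b ∈ N)
    (hN : N ≤ Subgroup.normalClosure {b : G | b ∈ v}) (j : ℕ) :
    ((N.lowerCentralSeries (j + 1) : Subgroup G) : Set G) ⊆
      (((l.map fun a => (a, N.lowerCentralSeries (j + 1))) ++
          (v.map fun b => (b, N.lowerCentralSeries j))).map fun p : G × Subgroup G =>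
            (fun y : G => ⁅y, p.1⁆) '' (p.2 : Set G)).prod *
        ((N.lowerCentralSeries (j + 2) : Subgroup G) : Set G) := by
  -- notation-free abbreviations: `K = γ_{j+1}`, `D = γ_{j+2} = ⁅K, N⁆`, `Kj = γ_j`
  have hK_le : N.lowerCentralSeries (j + 1) ≤ N := Subgroup.lowerCentralSeries_le_self N (j + 1)
  have hKj_le : N.lowerCentralSeries j ≤ N := Subgroup.lowerCentralSeries_le_self N j
  have hD : N.lowerCentralSeries (j + 2) = ⁅N.lowerCentralSeries (j + 1), N⁆ := rfl
  have hK : N.lowerCentralSeries (j + 1) = ⁅N.lowerCentralSeries j, N⁆ := rfl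
  have hKD : ⁅N.lowerCentralSeries (j + 1), N.lowerCentralSeries (j + 1)⁆ ≤
      N.lowerCentralSeries (j + 2) := by
    rw [hD]; exact Subgroup.commutator_mono le_rfl hK_le
  have hC : ∀ x ∈ N, ∀ c ∈ N.lowerCentralSeries (j + 1), ⁅c, x⁆ ∈ N.lowerCentralSeries (j + 2) :=
    fun x hx c hc => by rw [hD]; exact Subgroup.commutator_mem_commutator hc hx
  have hw : ∀ p ∈ ((l.map fun a => (a, N.lowerCentralSeries (j + 1))) ++
      (v.map fun b => (b, N.lowerCentralSeries j))),
      p.2 ≤ N ∧ ∀ y ∈ p.2, ⁅y, p.1⁆ ∈ N.lowerCentralSeries (j + 1) := by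
    intro p hp
    rcases List.mem_append.mp hp with hp | hp
    · obtain ⟨a, _, rfl⟩ := List.mem_map.mp hp
      exact ⟨hK_le, fun y hy => commutatorElement_mem_left hy a⟩
    · obtain ⟨b, hb, rfl⟩ := List.mem_map.mp hp
      exact ⟨hKj_le, fun y hy => by
        rw [hK]; exact Subgroup.commutator_mem_commutator hy (hv b hb)⟩
  obtain ⟨Y, hY⟩ := exists_subgroup_coe_eq_listProd_mul (D := N.lowerCentralSeries (j + 2)) N
    (N.lowerCentralSeries (j + 1)) hK_le hC hw
  rw [← hY, SetLike.coe_subset_coe]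
  -- basic membership facts for `Y = T(w) · D`
  have hTY : (((l.map fun a => (a, N.lowerCentralSeries (j + 1))) ++
      (v.map fun b => (b, N.lowerCentralSeries j))).map fun p : G × Subgroup G =>
        (fun y : G => ⁅y, p.1⁆) '' (p.2 : Set G)).prod ⊆ (Y : Set G) := by
    intro m hm
    rw [hY]
    exact Set.mem_mul.mpr ⟨m, hm, 1, Subgroup.one_mem _, mul_one m⟩
  have hDY : N.lowerCentralSeries (j + 2) ≤ Y := by
    intro d hd
    rw [← SetLike.mem_coe, hY]
    exact Set.mem_mul.mpr ⟨1, one_mem_listProd _, d, hd, one_mul d⟩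
  have hYK : Y ≤ N.lowerCentralSeries (j + 1) := by
    intro g hg
    rw [← SetLike.mem_coe, hY] at hg
    obtain ⟨m, hm, d, hd, rfl⟩ := Set.mem_mul.mp hg
    exact Subgroup.mul_mem _ (listProd_subset (fun p hp => (hw p hp).2) hm)
      (Subgroup.lowerCentralSeries_antitone N (Nat.le_succ (j + 1)) hd)
  -- `Y` is normalised by `N`
  have hYN : ∀ x ∈ N, ∀ g ∈ Y, x * g * x⁻¹ ∈ Y := by
    intro x hx g hg
    have hg' := hg
    rw [← SetLike.mem_coe, hY] at hg'
    obtain ⟨m, hm, d, hd, rfl⟩ := Set.mem_mul.mp hg'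
    have hmK : m ∈ N.lowerCentralSeries (j + 1) := listProd_subset (fun p hp => (hw p hp).2) hm
    rw [← SetLike.mem_coe, hY]
    refine Set.mem_mul.mpr ⟨m, hm, m⁻¹ * (x * (m * d) * x⁻¹), ?_, by rw [mul_inv_cancel_left]⟩
    have h1 : ⁅m⁻¹, x⁆ ∈ N.lowerCentralSeries (j + 2) := hC x hx _ (Subgroup.inv_mem _ hmK)
    have h2 : x * d * x⁻¹ ∈ N.lowerCentralSeries (j + 2) := Subgroup.Normal.conj_mem inferInstance d hd x
    have : m⁻¹ * (x * (m * d) * x⁻¹) = ⁅m⁻¹, x⁆ * (x * d * x⁻¹) := by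
      simp only [commutatorElement_def]; group
    rw [this]
    exact Subgroup.mul_mem _ h1 h2
  -- (A) for `K`: `⁅G, K⁆ ⊆ T((aᵢ, K)ᵢ) · D ⊆ Y`
  have hAK : ⁅(⊤ : Subgroup G), N.lowerCentralSeries (j + 1)⁆ ≤ Y := by
    intro g hg
    have hg' := commutator_top_subset_listProd_mul (N.lowerCentralSeries (j + 1))
      (N.lowerCentralSeries (j + 2)) hKD hl hg
    obtain ⟨m, hm, d, hd, rfl⟩ := Set.mem_mul.mp hg'
    refine Y.mul_mem (hTY ?_) (hDY hd)
    rw [listProd_append]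
    exact Set.mem_mul.mpr ⟨m, hm, 1, one_mem_listProd _, mul_one m⟩
  -- the key step: `⁅y, x⁆ ∈ Y` for `y ∈ γ_j` and `x` a conjugate of an entry of `v`
  have hgen : ∀ y ∈ N.lowerCentralSeries j, ∀ x ∈ Group.conjugatesOfSet {b : G | b ∈ v},
      ⁅y, x⁆ ∈ Y := by
    intro y hy x hx
    obtain ⟨b, hb, hbx⟩ := Group.mem_conjugatesOfSet_iff.mp hx
    obtain ⟨g, rfl⟩ := isConj_iff.mp hbx
    have hy₀ : g⁻¹ * y * g ∈ N.lowerCentralSeries j := by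
      simpa using Subgroup.Normal.conj_mem inferInstance y hy g⁻¹
    -- `c = ⁅g⁻¹ y g, b⁆ ∈ T(w) ⊆ Y`, `c ∈ K`
    have hcT : ⁅g⁻¹ * y * g, b⁆ ∈ Y := hTY (comm_mem_listProd
      (w := (l.map fun a => (a, N.lowerCentralSeries (j + 1))) ++
        (v.map fun b => (b, N.lowerCentralSeries j)))
      (p := (b, N.lowerCentralSeries j)) (List.mem_append_right _ (List.mem_map.mpr ⟨b, hb, rfl⟩)) hy₀)
    have hcK : ⁅g⁻¹ * y * g, b⁆ ∈ N.lowerCentralSeries (j + 1) := hYK hcT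
    have e : ⁅y, g * b * g⁻¹⁆ = ⁅g, ⁅g⁻¹ * y * g, b⁆⁆ * ⁅g⁻¹ * y * g, b⁆ := by
      simp only [commutatorElement_def]; group
    rw [e]
    exact Y.mul_mem (hAK (Subgroup.commutator_mem_commutator (Subgroup.mem_top g) hcK)) hcT
  -- closure induction over `normalClosure v = closure (conjugates of v)`
  have hall : ∀ x ∈ Subgroup.normalClosure {b : G | b ∈ v}, ∀ y ∈ N.lowerCentralSeries j,
      ⁅y, x⁆ ∈ Y := by
    intro x hx
    have hx' : x ∈ Subgroup.closure (Group.conjugatesOfSet {b : G | b ∈ v}) := hx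
    have hVN : Group.conjugatesOfSet {b : G | b ∈ v} ⊆ (N : Set G) := by
      intro x hx
      obtain ⟨b, hb, hbx⟩ := Group.mem_conjugatesOfSet_iff.mp hx
      obtain ⟨g, rfl⟩ := isConj_iff.mp hbx
      exact Subgroup.Normal.conj_mem inferInstance b (hv b hb) g
    refine Subgroup.closure_induction (p := fun x _ => ∀ y ∈ N.lowerCentralSeries j, ⁅y, x⁆ ∈ Y)
      ?_ ?_ ?_ ?_ hx'
    · exact fun x hx y hy => hgen y hy x hx
    · intro y _
      rw [commutatorElement_one_right]
      exact Y.one_mem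
    · intro x x' hx _ ih ih' y hy
      have hxN : x ∈ N := (Subgroup.closure_le N).mpr hVN hx
      rw [commutatorElement_mul_right_eq_mul_conj, mul_assoc (⁅y, x⁆ * x), mul_assoc ⁅y, x⁆,
        ← mul_assoc x]
      exact Y.mul_mem (ih y hy) (hYN x hxN _ (ih' y hy))
    · intro x hx ih y hy
      have hxN : x ∈ N := (Subgroup.closure_le N).mpr hVN hx
      rw [commutatorElement_inv_right]
      have := hYN x⁻¹ (N.inv_mem hxN) _ (Y.inv_mem (ih y hy))
      rwa [commutatorElement_inv, inv_inv] at this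
  -- conclusion: `K = ⁅γ_j, N⁆ ≤ Y`
  rw [hK, Subgroup.commutator_le]
  intro y hy x hx
  exact hall x (hN hx) y hy

/-! ### The induction along the lower central series of `N` -/

/-- **Width of `⁅G, N⁆` modulo `γ_{j+1}(N)`.** Let `N ⊴ G` be the normal closure of the entries of
`v` (all in `N`), and let the entries of `l` generate `G`.  Then for every `j`, every element of
`⁅G, N⁆` is congruent modulo `N.lowerCentralSeries (j+1)` to a product
`∏_{c ∈ l ++ v} ⁅x_c, c⁆` with all `x_c ∈ N`. [cite: DDMSAnalyticProP1999, Prop 1.19 (proof)] -/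
theorem commutator_top_subset_listProd_mul_lowerCentralSeries (N : Subgroup G) [N.Normal]
    {l : List G} (hl : Subgroup.closure {a : G | a ∈ l} = ⊤) {v : List G} (hv : ∀ b ∈ v, b ∈ N)
    (hN : N ≤ Subgroup.normalClosure {b : G | b ∈ v}) (j : ℕ) :
    ((⁅(⊤ : Subgroup G), N⁆ : Subgroup G) : Set G) ⊆
      (((l ++ v).map fun a => (a, N)).map fun p : G × Subgroup G =>
          (fun y : G => ⁅y, p.1⁆) '' (p.2 : Set G)).prod *
        ((N.lowerCentralSeries (j + 1) : Subgroup G) : Set G) := by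
  induction j with
  | zero =>
    intro g hg
    have hKD : ⁅N, N⁆ ≤ N.lowerCentralSeries (0 + 1) := le_rfl
    obtain ⟨m, hm, d, hd, rfl⟩ :=
      Set.mem_mul.mp (commutator_top_subset_listProd_mul N (N.lowerCentralSeries (0 + 1)) hKD hl hg)
    refine Set.mem_mul.mpr ⟨m, ?_, d, hd, rfl⟩
    rw [List.map_append, List.map_append, List.prod_append]
    exact Set.mem_mul.mpr ⟨m, hm, 1, one_mem_listProd _, mul_one m⟩
  | succ j ih =>
    intro g hg
    obtain ⟨u, hu, r, hr, rfl⟩ := Set.mem_mul.mp (ih hg)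
    obtain ⟨t, ht, d, hd, rfl⟩ :=
      Set.mem_mul.mp (lowerCentralSeries_succ_subset_listProd_mul N hl hv hN j hr)
    -- `t` is a "deep" product for the list `(l ++ v).map (·, N)` and `C = γ_{j+1}`
    have hforall : List.Forall₂
        (fun p q : G × Subgroup G => p.1 = q.1 ∧ p.2 ≤ q.2 ∧
          ∀ y ∈ p.2, ⁅y, p.1⁆ ∈ N.lowerCentralSeries (j + 1))
        ((l.map fun a => (a, N.lowerCentralSeries (j + 1))) ++
          (v.map fun b => (b, N.lowerCentralSeries j)))
        (((l ++ v).map fun a => (a, N))) := by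
      rw [List.map_append]
      refine List.rel_append (forall₂_map_map_of_forall fun a _ => ?_)
        (forall₂_map_map_of_forall fun b hb => ?_)
      · exact ⟨rfl, Subgroup.lowerCentralSeries_le_self N (j + 1),
          fun y hy => commutatorElement_mem_left hy a⟩
      · exact ⟨rfl, Subgroup.lowerCentralSeries_le_self N j,
          fun y hy => Subgroup.commutator_mem_commutator hy (hv b hb)⟩
    have htdeep := listProd_subset_deep hforall ht
    have hC : ∀ x ∈ N, ∀ c ∈ N.lowerCentralSeries (j + 1), ⁅c, x⁆ ∈ N.lowerCentralSeries (j + 2) :=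
      fun x hx c hc => Subgroup.commutator_mem_commutator hc hx
    have hW : ∀ p ∈ ((l ++ v).map fun a => (a, N)), p.2 ≤ N ∧ ∀ y ∈ p.2, ⁅y, p.1⁆ ∈ N := by
      intro p hp
      obtain ⟨a, _, rfl⟩ := List.mem_map.mp hp
      exact ⟨le_rfl, fun y hy => commutatorElement_mem_left hy a⟩
    obtain ⟨m, hm, hmeq⟩ := exists_listProd_mk_eq_mul_deep (D := N.lowerCentralSeries (j + 2)) N
      (N.lowerCentralSeries (j + 1)) hC _ hW u t hu htdeep
    rw [QuotientGroup.mk'_apply, QuotientGroup.mk'_apply] at hmeq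
    have hmut : m⁻¹ * (u * t) ∈ N.lowerCentralSeries (j + 2) := QuotientGroup.eq.mp hmeq
    refine Set.mem_mul.mpr ⟨m, hm, m⁻¹ * (u * t) * d, Subgroup.mul_mem _ hmut hd, ?_⟩
    group

/-! ### The width theorem -/

/-- `T((c, N)_c) ⊆ ⁅G, N⁆` (the easy inclusion of the width theorem).
[cite: DDMSAnalyticProP1999, Prop 1.19 (proof)] -/
theorem listProd_subset_commutator_top (N : Subgroup G) (w : List G) :
    ((w.map fun a => (a, N)).map fun p : G × Subgroup G =>
        (fun y : G => ⁅y, p.1⁆) '' (p.2 : Set G)).prod ⊆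
      ((⁅(⊤ : Subgroup G), N⁆ : Subgroup G) : Set G) := by
  refine listProd_subset fun p hp y hy => ?_
  obtain ⟨a, _, rfl⟩ := List.mem_map.mp hp
  rw [Subgroup.commutator_comm]
  exact Subgroup.commutator_mem_commutator hy (Subgroup.mem_top a)

/-- **Commutator width of `⁅G, N⁆` for a nilpotent normal subgroup.**  Let the entries `a₁, …, a_d`
of `l` generate `G`, let `N ⊴ G` be the normal closure of the entries `b₁, …, b_e ∈ N` of `v`, and
suppose the lower central series of `N` (computed in `G`) reaches `⊥`.  Then
`⁅G, N⁆ = {⁅x₁,a₁⁆ ⋯ ⁅x_d,a_d⁆ ⁅y₁,b₁⁆ ⋯ ⁅y_e,b_e⁆ | xᵢ, yⱼ ∈ N}`: every element of `⁅G, N⁆` is a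
product of `d + e` commutators with entries from `N` and the fixed elements `aᵢ`, `bⱼ`, in the order
of the list `l ++ v`. [cite: DDMSAnalyticProP1999, Prop 1.19 (proof)] -/
theorem commutator_top_eq_listProd_of_lowerCentralSeries_eq_bot (N : Subgroup G) [N.Normal]
    {l : List G} (hl : Subgroup.closure {a : G | a ∈ l} = ⊤) {v : List G} (hv : ∀ b ∈ v, b ∈ N)
    (hN : N ≤ Subgroup.normalClosure {b : G | b ∈ v}) {c : ℕ} (hc : N.lowerCentralSeries c = ⊥) :
    ((⁅(⊤ : Subgroup G), N⁆ : Subgroup G) : Set G) =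
      (((l ++ v).map fun a => (a, N)).map fun p : G × Subgroup G =>
          (fun y : G => ⁅y, p.1⁆) '' (p.2 : Set G)).prod := by
  refine Set.Subset.antisymm ?_ (listProd_subset_commutator_top N (l ++ v))
  have h := commutator_top_subset_listProd_mul_lowerCentralSeries N hl hv hN c
  have hbot : N.lowerCentralSeries (c + 1) = ⊥ :=
    le_bot_iff.mp (hc ▸ Subgroup.lowerCentralSeries_antitone N (Nat.le_succ c))
  rwa [hbot, Subgroup.coe_bot, Set.singleton_one, mul_one] at h

/-- **Commutator width of `⁅G, N⁆` for a nilpotent normal subgroup**, `Group.IsNilpotent` phrasing: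
if the entries of `l` generate `G` and the NILPOTENT normal subgroup `N` is the normal closure of the
entries of `v` (all in `N`), then every element of `⁅G, N⁆` is a product
`⁅x₁,a₁⁆ ⋯ ⁅x_d,a_d⁆ ⁅y₁,b₁⁆ ⋯ ⁅y_e,b_e⁆` with `xᵢ, yⱼ ∈ N` (commutator width `≤ d + e`).
[cite: DDMSAnalyticProP1999, Prop 1.19 (proof)] -/
theorem commutator_top_eq_listProd_of_isNilpotent (N : Subgroup G) [N.Normal] [Group.IsNilpotent N]
    {l : List G} (hl : Subgroup.closure {a : G | a ∈ l} = ⊤) {v : List G} (hv : ∀ b ∈ v, b ∈ N)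
    (hN : N ≤ Subgroup.normalClosure {b : G | b ∈ v}) :
    ((⁅(⊤ : Subgroup G), N⁆ : Subgroup G) : Set G) =
      (((l ++ v).map fun a => (a, N)).map fun p : G × Subgroup G =>
          (fun y : G => ⁅y, p.1⁆) '' (p.2 : Set G)).prod := by
  obtain ⟨c, hc⟩ := (Subgroup.isNilpotent_iff_lowerCentralSeries N).mp ‹Group.IsNilpotent N›
  exact commutator_top_eq_listProd_of_lowerCentralSeries_eq_bot N hl hv hN hc

end NilpotentNormalWidth

end Literature.GroupTheory
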